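import Summits.QuantumFields.BalabanUV.T4Continuum.Support.SpreadLiftDirection

/-!
# SpreadLiftMap (T⁴ programme, node NE3, crew row S6-Y7 (c) `replicationRightInverse`, file 3/5) — THE SPREAD LIFT MAP OF A
# COARSE BOND IS `id + O(d·L²·a)`: `‖Φ_c(spreadLift m) − m‖ ≤ 64·d·L²·a·‖m‖` for `U(N)` data with `|V(∂p) − 1| ≤ a` and loop
# bound `w ≤ 1/32` — NO factor `L^d` (contrast: the one-bond lift map of `AveragingDeficitLiftMap` is `L^{1−d}·id + O(w)`)

HONEST FRAMING (cell `pub-balaban`, T4-DAG PAGE 1; unit `b2b-balaban-t4-ne3-formalise-leaf-01` gen 3, NE3 (node U1b)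
formalisation swarm, crew sub-row **S6-Y7 (c)** of `t4/formal/NE3/LEAVES.md` = leaf **L7(c) `replicationRightInverse`** of
the road-P3 skeleton `t4/skeletons/NE3-t4-ne3-p3.md` §2).  The cell's T4 target is the finite-torus continuum limit of the
unit-scale averaged loop expectations — NOT infinite volume, NO mass gap, NOT Clay, NOT summit progress.  All [folklore],
0 sorry: §1 the lift map `spreadMap L V y κ : m ↦ pushDir L V (spreadLift L V (bondDir y κ m)) (Ly, κ)` (ℝ-linear by
`AveragingDeficitPushForwardLinear.pushDir_add/smul`) and LOCALITY: `pushDir L V (spreadLift L V φ) (Ly, κ) = spreadMap … (φ y κ)`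
(`pushDir_spreadLift`: on the words of `c` the spread lift sees only `φ(c)`, file 1's classification); §2 THE STAIR LOOP
`Γ_{q′, q′+r⊥} ∪ [q′+r⊥, q′+r] ∪ −Γ_{q′, q′+r}` at `q′ = L(y + e_κ)` (area `≤ dL²`): `‖V(stair) − 1‖ ≤ d·L²·a` via the axial
gauge of B7 p. 24 (`B7Prop1Explicit.axial_bond_bound`, `hol_axial_treeWord`) — this loop is EXACTLY the discrepancy between
the transported value on the crossing bond of `Γ_{c,x}` and the value `−Γ_c` gives back; §3 **THE ESTIMATE**
`norm_spreadMap_sub_le`: along each of the `L^d` loops of (42) the spread lift is seen as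
`δloop_x = Ad_g(Ad_{K⁻¹}m − Ad_k m)`, `‖δloop_x‖ ≤ 2dL²a‖m‖` (§2), hence `(log W_x)′ = J⁻¹Ad_{W⁻¹}δloop_x = O(dL²a)|m|`
(`jexp_mlog_eq_Ad`, `norm_le_norm_jexp`), `X_c′ = O(dL²a)|m|`, `Φ(c) = m + Ad_{V(Γ_c)⁻¹}J_{X_c}(X_c′) = m + O(dL²a)|m|`
(file 1's `pushDir_crossSupported`; constants `2 → 32 → 64`).  File 3 inverts (`64dL²a ≤ 1/2` under the tree's standard
`512(d+1)(d+4)L²a ≤ 1`) and assembles the one-level right inverse; file 4 climbs the tower.  NOT NE3 in disguise: one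
averaging operator, one background, matrix calculus.  NE3 is NOT proved by this file.
CITATION HEADER: no printed sentence is a hypothesis; the manuscripts under audit are not cited for any disputed step;
context: T. Bałaban, Commun. Math. Phys. **98** (1985) 17–51 [Balaban1985Averaging] ((9) p. 18, (42) p. 23, p. 24–25,
(139)–(147) p. 39–40: `|Q_k(U₀; c, b)| ≤ 1 + 2C′₁α₀`, the printed uniform bound this construction mirrors for the inverse).
PLACEMENT: `Summits/QuantumFields/BalabanUV/` (human rule 2026-08-19).  Record: HOME `t4/formal/NE3/LEAVES.md` row S5∕S6.
-/

set_option autoImplicit false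

open scoped BigOperators Matrix Matrix.Norms.L2Operator Topology
open NormedSpace Finset Filter

namespace Summit.QuantumFields.BalabanUV.T4Continuum.SpreadLiftMap

open Literature.MathematicalPhysics.QuantumFieldTheory.Balaban1983to89
open B7Prop1Explicit B7Prop2Explicit MatrixLog UnitaryModel
open T4AveragingDeficitWall hiding Site Plane Plaq Bond
open T4AveragingDeficitNonAbelian (Ad_mul Ad_sub)
open AveragingDeficitTransport AveragingDeficitLocality AveragingDeficitNearIdentity AveragingDeficitSideDeriv
open AveragingDeficitResidualPairing AveragingDeficitTransportCalc AveragingDeficitPushForwardLinear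
open AveragingDeficitFaceWords (faceSite boxVec_bounds)
open AveragingDeficitLiftMap (bondDir bondDir_self bondDir_add bondDir_smul LoopBound)
open SkeletonLattice (cdiv cmod)
open SpreadLiftWords SpreadLiftDirection

noncomputable section

variable {d : ℕ} {n : Type*} [Fintype n] [DecidableEq n]

/-! ## §1 The estimate: `spreadMap = id + O(d·L²·a)` -/

/-- `‖Ad_{u⁻¹} m − Ad_k m‖ ≤ 2‖uk − 1‖‖m‖` for unitary units. [folklore] -/
theorem norm_Ad_inv_sub_Ad_le [Nonempty n] {u k : (Matrix n n ℂ)ˣ} (hu : u ∈ unitaryUnits (Matrix n n ℂ)) (hk : k ∈ unitaryUnits (Matrix n n ℂ)) (m : (Matrix n n ℂ)) :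
    ‖Ad u⁻¹ m - Ad k m‖ ≤ 2 * ‖((u * k : (Matrix n n ℂ)ˣ) : (Matrix n n ℂ)) - 1‖ * ‖m‖ := by
  have e : Ad u⁻¹ m - Ad k m = Ad k (Ad (u * k)⁻¹ m - m) := by
    rw [Ad_sub, ← Ad_mul, mul_inv_rev, ← mul_assoc, mul_inv_cancel, one_mul]
  have huk : u * k ∈ unitaryUnits (Matrix n n ℂ) := (unitaryUnits (Matrix n n ℂ)).mul_mem hu hk
  rw [e, norm_Ad_of_unitary hk]
  refine (norm_Ad_sub_le ((unitaryUnits (Matrix n n ℂ)).inv_mem huk) m).trans ?_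
  gcongr
  exact norm_inv_sub_one_le (mem_U1_of_unitary huk)

/-- **ALONG EACH LOOP OF (42) THE SPREAD LIFT IS SMALL**: `‖(δ_ψV)(loop_{c,x})‖ ≤ 2·d·L²·a·‖m‖` for
`ψ = spreadLift (bondDir c m)` (the transported value on `b_x` against the value `−Γ_c` returns; their discrepancy is the
stair loop of §2). [cite: Balaban1985Averaging, (42) p.23, p.24–25] -/
theorem norm_dhol_loopWord_spreadLift_le [Nonempty n] {L : ℕ} (hL : 1 ≤ L) {V : Site d → Fin d → (Matrix n n ℂ)ˣ}
    (hV : IsUnitaryCfg V) {a : ℝ} (ha : 0 ≤ a) (hVa : SmallField V a) (y : Site d) (κ : Fin d) (m : (Matrix n n ℂ))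
    (r : Fin d → Fin L) :
    ‖dhol V (spreadLift L V (bondDir y κ m)) ((L : ℤ) • y) (loopWord L κ (boxVec L r))‖ ≤ 2 * (d * (L : ℝ) ^ 2 * a) * ‖m‖ := by
  set q : Site d := (L : ℤ) • y with hq
  set q' : Site d := (L : ℤ) • (y + e κ) with hq'
  set ψ := spreadLift L V (bondDir y κ m) with hψ
  have hψs : CrossSupported L ψ := crossSupported_spreadLift L V _
  -- the transports
  set g : (Matrix n n ℂ)ˣ := hol V q (treeWord (boxVec L r) ++ seg κ (((L - 1 - (r κ : ℕ) : ℕ) : ℤ) + 1)) with hg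
  set K : (Matrix n n ℂ)ˣ := hol V q' (treeWord (boxVec L (perpOff hL κ r))) with hK
  set k : (Matrix n n ℂ)ˣ := hol V (q' + boxVec L (perpOff hL κ r)) (seg κ ((r κ : ℕ) : ℤ) ++ revWord (treeWord (boxVec L r)))
    with hk
  have hgu : g ∈ unitaryUnits (Matrix n n ℂ) := hol_mem_of hV _ _
  have hKu : K ∈ unitaryUnits (Matrix n n ℂ) := hol_mem_of hV _ _
  have hku : k ∈ unitaryUnits (Matrix n n ℂ) := hol_mem_of hV _ _
  -- the values of ψ on the two live bonds
  have hbx : ψ (q + boxVec L (crossOff hL κ r)) κ = Ad K⁻¹ m := by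
    rw [hψ, hq, spreadLift_crossSite hL, bondDir_self]
  have hb0 : ψ (faceSite L y κ) κ = m := by rw [hψ, spreadLift_faceSite hL, bondDir_self]
  -- `V(Γ_{c,x}) = g · k`
  have hgk : hol V q (gammaWord L κ (boxVec L r)) = g * k := by
    rw [gammaWord_split, hol_append, hq, disp_firstHalf hL]
  -- `K · k = V(stair)`
  have hKk : K * k = hol V q' (stairLoop hL κ r) := by
    rw [stairLoop, hol_append, disp_treeWord]
  rw [hq] at hgk
  rw [dhol_loopWord hL hψs y κ r, ← hq, hbx, hb0, ← hg, hgk, Ad_mul, ← Ad_sub, norm_Ad_of_unitary hgu]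
  refine (norm_Ad_inv_sub_Ad_le hKu hku m).trans ?_
  rw [hKk]
  have := norm_hol_stairLoop_sub_one_le hL hV ha hVa q' κ r
  gcongr

set_option maxHeartbeats 800000 in
/-- **THE ESTIMATE**: `‖spreadMap m − m‖ ≤ 64·d·L²·a·‖m‖` for `U(N)` data with `|V(∂p) − 1| ≤ a` and loop bound `w ≤ 1/32`.
[cite: Balaban1985Averaging, (42) p.23, p.25, (139)–(147) p.39–40] -/
theorem norm_spreadMap_sub_le [Nonempty n] {L : ℕ} (hL : 1 ≤ L) {V : Site d → Fin d → (Matrix n n ℂ)ˣ} (hV : IsUnitaryCfg V)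
    {a : ℝ} (ha : 0 ≤ a) (hVa : SmallField V a) (y : Site d) (κ : Fin d) {w : ℝ} (hw : w ≤ 1 / 32)
    (hW : LoopBound L V y κ w) (m : (Matrix n n ℂ)) :
    ‖spreadMap L V y κ hw hW m - m‖ ≤ 64 * (d * (L : ℝ) ^ 2 * a) * ‖m‖ := by
  letI : CStarAlgebra (Matrix n n ℂ) := {}
  set θ : ℝ := d * (L : ℝ) ^ 2 * a with hθ
  have hθ0 : 0 ≤ θ := by positivity
  set q : Site d := (L : ℤ) • y with hq
  set ψ : Site d → Fin d → (Matrix n n ℂ) := spreadLift L V (bondDir y κ m) with hψ_def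
  have hψ : CrossSupported L ψ := crossSupported_spreadLift L V _
  have hψm : ψ (faceSite L y κ) κ = m := by rw [hψ_def, spreadLift_faceSite hL, bondDir_self]
  set P₀ : (Matrix n n ℂ)ˣ := hol V q (seg κ (L : ℤ)) with hP₀
  have hP₀u : P₀ ∈ unitaryUnits (Matrix n n ℂ) := hol_mem_of hV _ _
  set X : (Matrix n n ℂ) := Xavg L V q κ with hX
  set X' : (Matrix n n ℂ) := XavgDeriv L V ψ q κ with hX'
  have hw0 : 0 ≤ w := (norm_nonneg _).trans (hW (fun _ => ⟨0, hL⟩))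
  -- per-loop quantities
  have hWu : ∀ r : Fin d → Fin L, Wcx L V q κ (boxVec L r) ∈ unitaryUnits (Matrix n n ℂ) := fun r =>
    (unitaryUnits (Matrix n n ℂ)).mul_mem (hol_mem_of hV _ _) ((unitaryUnits (Matrix n n ℂ)).inv_mem (hol_mem_of hV _ _))
  have hW1 : ∀ r : Fin d → Fin L, ‖((Wcx L V q κ (boxVec L r) : (Matrix n n ℂ)ˣ) : (Matrix n n ℂ)) - 1‖ < 1 := fun r =>
    (hW r).trans_lt (by linarith)
  have hXr : ∀ r : Fin d → Fin L, ‖mlog ((Wcx L V q κ (boxVec L r) : (Matrix n n ℂ)ˣ) : (Matrix n n ℂ))‖ ≤ 2 * w := fun r =>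
    (norm_mlog_le_two_mul ((hW r).trans (by linarith))).trans (by linarith [hW r])
  -- `Y_r = (log W_r)′ = O(θ)|m|`
  have hY : ∀ r : Fin d → Fin L, ‖mlogDeriv L V ψ q κ (boxVec L r)‖ ≤ 32 * θ * ‖m‖ := by
    intro r
    set W : (Matrix n n ℂ)ˣ := Wcx L V q κ (boxVec L r) with hWdef
    set Y : (Matrix n n ℂ) := mlogDeriv L V ψ q κ (boxVec L r) with hYdef
    have hJ : jexp (mlog (W : (Matrix n n ℂ))) Y = Ad W⁻¹ (dhol V ψ q (loopWord L κ (boxVec L r))) :=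
      jexp_mlog_eq_Ad L V ψ q κ r (hW1 r)
    have hZn : ‖jexp (mlog (W : (Matrix n n ℂ))) Y‖ ≤ 2 * θ * ‖m‖ := by
      rw [hJ, norm_Ad_of_unitary ((unitaryUnits (Matrix n n ℂ)).inv_mem (hWu r))]
      exact norm_dhol_loopWord_spreadLift_le hL hV ha hVa y κ m r
    have hXn : ‖mlog (W : (Matrix n n ℂ))‖ ≤ 2 * w := hXr r
    have hX1 : ‖mlog (W : (Matrix n n ℂ))‖ ≤ 1 := by linarith
    have hlow := norm_le_norm_jexp (mlog (W : (Matrix n n ℂ))) Y hX1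
    have h16 : (1 : ℝ) / 16 ≤ 1 - 15 * ‖mlog (W : (Matrix n n ℂ))‖ := by linarith
    have := mul_le_mul_of_nonneg_right h16 (norm_nonneg Y)
    nlinarith [norm_nonneg Y, norm_nonneg m]
  -- `X′ = O(θ)|m|`
  have hX'n : ‖X'‖ ≤ 32 * θ * ‖m‖ := by
    rw [hX', XavgDeriv]
    exact norm_avg_le L hL _ hY
  -- `J_X(X′) = O(θ)|m|`
  have hXn : ‖X‖ ≤ 2 * w := norm_Xavg_le L hL V q κ (hw.trans (by norm_num)) hW
  have hJn : ‖jexp X X'‖ ≤ 64 * θ * ‖m‖ := by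
    have h1 := norm_jexp_sub_le X X' (by linarith)
    have h2 : ‖jexp X X'‖ ≤ ‖jexp X X' - X'‖ + ‖X'‖ := by
      have := norm_add_le (jexp X X' - X') X'
      rwa [sub_add_cancel] at this
    have h3 : 15 * ‖X‖ * ‖X'‖ ≤ 1 * ‖X'‖ := by
      refine mul_le_mul_of_nonneg_right ?_ (norm_nonneg _)
      nlinarith
    nlinarith [norm_nonneg X']
  -- assemble: `spreadMap m − m = Ad_{P₀⁻¹} J_X(X′)`
  have hform : spreadMap L V y κ hw hW m - m = Ad P₀⁻¹ (jexp X X') := by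
    rw [spreadMap_apply, ← hψ_def, ← hq, pushDir_crossSupported hL hψ y κ, hψm, ← hq, ← hP₀, ← hX, ← hX']
    abel
  rw [hform, norm_Ad_of_unitary ((unitaryUnits (Matrix n n ℂ)).inv_mem hP₀u)]
  exact hJn

/-- The spread lift map preserves skew-adjointness. [folklore] -/
theorem spreadMap_mem_skew {L : ℕ} {V : Site d → Fin d → (Matrix n n ℂ)ˣ} (hV : IsUnitaryCfg V) (y : Site d) (κ : Fin d)
    {w : ℝ} (hw : w ≤ 1 / 32) (hW : LoopBound L V y κ w) {m : (Matrix n n ℂ)} (hm : m ∈ skewAdjoint (Matrix n n ℂ)) :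
    spreadMap L V y κ hw hW m ∈ skewAdjoint (Matrix n n ℂ) := by
  rw [spreadMap_apply]
  refine pushDir_mem_skewAdjoint L hV (isSkewDir_spreadLift L hV fun y' κ' => ?_) _ κ
    fun r => (hW r).trans_lt (by linarith)
  unfold bondDir
  split_ifs
  · exact hm
  · exact (skewAdjoint (Matrix n n ℂ)).zero_mem


/-! ## §2 Inversion: the lift map is a linear automorphism of `𝔤𝔩(N, ℂ)` and of `𝔲(N)`, with inverse `id + O(d·L²·a)` -/

/-- **LOWER BOUND**: `‖spreadMap m‖ ≥ (1 − 64dL²a)‖m‖`. [folklore] -/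
theorem norm_spreadMap_ge [Nonempty n] {L : ℕ} (hL : 1 ≤ L) {V : Site d → Fin d → (Matrix n n ℂ)ˣ} (hV : IsUnitaryCfg V)
    {a : ℝ} (ha : 0 ≤ a) (hVa : SmallField V a) (y : Site d) (κ : Fin d) {w : ℝ} (hw : w ≤ 1 / 32)
    (hW : LoopBound L V y κ w) (m : Matrix n n ℂ) :
    (1 - 64 * (d * (L : ℝ) ^ 2 * a)) * ‖m‖ ≤ ‖spreadMap L V y κ hw hW m‖ := by
  have h1 := norm_spreadMap_sub_le hL hV ha hVa y κ hw hW m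
  have h2 : ‖m‖ ≤ ‖spreadMap L V y κ hw hW m‖ + ‖spreadMap L V y κ hw hW m - m‖ := by
    have := norm_sub_le (spreadMap L V y κ hw hW m) (spreadMap L V y κ hw hW m - m)
    rwa [sub_sub_cancel] at this
  nlinarith

/-- **INJECTIVITY** for `128·d·L²·a ≤ 1`. [folklore] -/
theorem spreadMap_injective [Nonempty n] {L : ℕ} (hL : 1 ≤ L) {V : Site d → Fin d → (Matrix n n ℂ)ˣ}
    (hV : IsUnitaryCfg V) {a : ℝ} (ha : 0 ≤ a) (hVa : SmallField V a) (h128 : 128 * (d * (L : ℝ) ^ 2 * a) ≤ 1)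
    (y : Site d) (κ : Fin d) {w : ℝ} (hw : w ≤ 1 / 32) (hW : LoopBound L V y κ w) :
    Function.Injective (spreadMap L V y κ hw hW) := by
  intro m m' h
  have h1 := norm_spreadMap_ge hL hV ha hVa y κ hw hW (m - m')
  rw [map_sub, h, sub_self, norm_zero] at h1
  have h2 : ‖m - m'‖ ≤ 0 := by nlinarith [norm_nonneg (m - m')]
  exact sub_eq_zero.mp (norm_le_zero_iff.mp h2)

/-- **THE INVERSE OF THE SPREAD LIFT MAP** (finite dimension: an injective endomorphism is an automorphism,
`LinearEquiv.ofInjectiveEndo`). [folklore] -/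
def spreadInv [Nonempty n] {L : ℕ} (hL : 1 ≤ L) {V : Site d → Fin d → (Matrix n n ℂ)ˣ} (hV : IsUnitaryCfg V)
    {a : ℝ} (ha : 0 ≤ a) (hVa : SmallField V a) (h128 : 128 * (d * (L : ℝ) ^ 2 * a) ≤ 1) (y : Site d) (κ : Fin d)
    {w : ℝ} (hw : w ≤ 1 / 32) (hW : LoopBound L V y κ w) : Matrix n n ℂ →ₗ[ℝ] Matrix n n ℂ :=
  ((LinearEquiv.ofInjectiveEndo (spreadMap L V y κ hw hW) (spreadMap_injective hL hV ha hVa h128 y κ hw hW)).symm :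
    Matrix n n ℂ →ₗ[ℝ] Matrix n n ℂ)

/-- `spreadMap (spreadInv v) = v`. [folklore] -/
theorem spreadMap_spreadInv [Nonempty n] {L : ℕ} (hL : 1 ≤ L) {V : Site d → Fin d → (Matrix n n ℂ)ˣ}
    (hV : IsUnitaryCfg V) {a : ℝ} (ha : 0 ≤ a) (hVa : SmallField V a) (h128 : 128 * (d * (L : ℝ) ^ 2 * a) ≤ 1)
    (y : Site d) (κ : Fin d) {w : ℝ} (hw : w ≤ 1 / 32) (hW : LoopBound L V y κ w) (v : Matrix n n ℂ) :
    spreadMap L V y κ hw hW (spreadInv hL hV ha hVa h128 y κ hw hW v) = v :=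
  (LinearEquiv.ofInjectiveEndo _ (spreadMap_injective hL hV ha hVa h128 y κ hw hW)).apply_symm_apply v

/-- `spreadInv (spreadMap m) = m`. [folklore] -/
theorem spreadInv_spreadMap [Nonempty n] {L : ℕ} (hL : 1 ≤ L) {V : Site d → Fin d → (Matrix n n ℂ)ˣ}
    (hV : IsUnitaryCfg V) {a : ℝ} (ha : 0 ≤ a) (hVa : SmallField V a) (h128 : 128 * (d * (L : ℝ) ^ 2 * a) ≤ 1)
    (y : Site d) (κ : Fin d) {w : ℝ} (hw : w ≤ 1 / 32) (hW : LoopBound L V y κ w) (m : Matrix n n ℂ) :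
    spreadInv hL hV ha hVa h128 y κ hw hW (spreadMap L V y κ hw hW m) = m :=
  (LinearEquiv.ofInjectiveEndo _ (spreadMap_injective hL hV ha hVa h128 y κ hw hW)).symm_apply_apply m

/-- **THE INVERSE IS `id + O(d·L²·a)`**: `‖spreadInv v‖ ≤ (1 + 128dL²a)‖v‖` and `‖spreadInv v − v‖ ≤ 128dL²a·‖v‖`. [folklore] -/
theorem norm_spreadInv_le [Nonempty n] {L : ℕ} (hL : 1 ≤ L) {V : Site d → Fin d → (Matrix n n ℂ)ˣ}
    (hV : IsUnitaryCfg V) {a : ℝ} (ha : 0 ≤ a) (hVa : SmallField V a) (h128 : 128 * (d * (L : ℝ) ^ 2 * a) ≤ 1)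
    (y : Site d) (κ : Fin d) {w : ℝ} (hw : w ≤ 1 / 32) (hW : LoopBound L V y κ w) (v : Matrix n n ℂ) :
    ‖spreadInv hL hV ha hVa h128 y κ hw hW v‖ ≤ (1 + 128 * (d * (L : ℝ) ^ 2 * a)) * ‖v‖
      ∧ ‖spreadInv hL hV ha hVa h128 y κ hw hW v - v‖ ≤ 128 * (d * (L : ℝ) ^ 2 * a) * ‖v‖ := by
  set θ : ℝ := d * (L : ℝ) ^ 2 * a with hθ
  set m := spreadInv hL hV ha hVa h128 y κ hw hW v with hm
  have hMm : spreadMap L V y κ hw hW m = v := spreadMap_spreadInv hL hV ha hVa h128 y κ hw hW v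
  have h1 := norm_spreadMap_sub_le hL hV ha hVa y κ hw hW m
  rw [hMm] at h1
  have hθ0 : 0 ≤ θ := by positivity
  have h2 : ‖m‖ ≤ ‖v‖ + ‖v - m‖ := by
    have := norm_sub_le v (v - m); rwa [sub_sub_cancel] at this
  have h3 : ‖m - v‖ = ‖v - m‖ := norm_sub_rev _ _
  -- `(1 − 64θ)‖m‖ ≤ ‖v‖` and `64θ ≤ 1/2` ⇒ `‖m‖ ≤ 2‖v‖` ⇒ `‖m‖ ≤ ‖v‖ + 64θ·2‖v‖`
  have h5 : ‖m‖ ≤ ‖v‖ + 64 * θ * ‖m‖ := by linarith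
  have h6 : ‖m‖ ≤ 2 * ‖v‖ := by
    have : (1 / 2 : ℝ) * ‖m‖ ≤ (1 - 64 * θ) * ‖m‖ :=
      mul_le_mul_of_nonneg_right (by linarith) (norm_nonneg m)
    nlinarith
  have h4 : ‖m‖ ≤ (1 + 128 * θ) * ‖v‖ := by
    have : 64 * θ * ‖m‖ ≤ 64 * θ * (2 * ‖v‖) := mul_le_mul_of_nonneg_left h6 (by positivity)
    nlinarith
  refine ⟨h4, ?_⟩
  rw [h3]
  have hcoef : 64 * θ * (1 + 128 * θ) ≤ 128 * θ := by nlinarith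
  calc ‖v - m‖ ≤ 64 * θ * ‖m‖ := h1
    _ ≤ 64 * θ * ((1 + 128 * θ) * ‖v‖) := mul_le_mul_of_nonneg_left h4 (by positivity)
    _ = (64 * θ * (1 + 128 * θ)) * ‖v‖ := by ring
    _ ≤ 128 * θ * ‖v‖ := mul_le_mul_of_nonneg_right hcoef (norm_nonneg v)

/-- **THE INVERSE PRESERVES `𝔲(N)`**: the lift map restricts to an injective — hence surjective — endomorphism of the
skew-adjoint real subspace. [folklore] -/
theorem spreadInv_mem_skew [Nonempty n] {L : ℕ} (hL : 1 ≤ L) {V : Site d → Fin d → (Matrix n n ℂ)ˣ}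
    (hV : IsUnitaryCfg V) {a : ℝ} (ha : 0 ≤ a) (hVa : SmallField V a) (h128 : 128 * (d * (L : ℝ) ^ 2 * a) ≤ 1)
    (y : Site d) (κ : Fin d) {w : ℝ} (hw : w ≤ 1 / 32) (hW : LoopBound L V y κ w) {v : Matrix n n ℂ}
    (hv : v ∈ skewAdjoint (Matrix n n ℂ)) : spreadInv hL hV ha hVa h128 y κ hw hW v ∈ skewAdjoint (Matrix n n ℂ) := by
  have hmaps : ∀ x ∈ skewAdjoint.submodule ℝ (Matrix n n ℂ),
      spreadMap L V y κ hw hW x ∈ skewAdjoint.submodule ℝ (Matrix n n ℂ) :=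
    fun x hx => spreadMap_mem_skew hV y κ hw hW hx
  set T := (spreadMap L V y κ hw hW).restrict hmaps with hT
  have hinj : Function.Injective T := by
    intro p q h
    have h' : spreadMap L V y κ hw hW p = spreadMap L V y κ hw hW q := by
      have := congrArg Subtype.val h
      simpa [hT] using this
    exact Subtype.ext (spreadMap_injective hL hV ha hVa h128 y κ hw hW h')
  obtain ⟨m, hm⟩ := (LinearMap.injective_iff_surjective.mp hinj) ⟨v, hv⟩
  have hm' : spreadMap L V y κ hw hW m = v := by
    have := congrArg Subtype.val hm
    simpa [hT] using this
  have : spreadInv hL hV ha hVa h128 y κ hw hW v = m := by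
    rw [← hm', spreadInv_spreadMap]
  rw [this]
  exact m.2

end

end Summit.QuantumFields.BalabanUV.T4Continuum.SpreadLiftMap
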